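/-
Copyright: derived here (Resolution Observatory cell `pub-rosobs`, carver gen 50). AI-written Lean; AI review is
weaker than expert review.  Companion file of the cell's POLYNOMIAL weighted-centre model `W(f)`: the abstract core of STEP 4_Q of
engine 1's LEMMA LQ ("no bands"; THEOREM-FQ-eng1-g34 §15.1; CARVER-NOTES-eng1-g34 T21).  Instrument — NOT a resolution theorem and NOT
a statement about the invariant of [AbramovichTemkinWlodarczyk2024].
-/
import Mathlib.Algebra.Polynomial.Derivative
import Mathlib.Algebra.CharP.Basic
import HarnessLib

/-!
# No-bands core: `Ψ̄ ∘ X̄ = ∂_σ ∘ Ψ̄` on `σ`-free elements and `Ψ̄(G₀) = G₀ − c^p σ^{e} K` (`p ∣ e`) force `X̄ G₀ = 0`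

Setting: `R` a commutative ring of characteristic `p`, `S = R[σ] = R[X]`, a ring endomorphism `Ψ̄ : S → S` (the cell's substitution; it need
NOT be `R`-linear) which is injective, and ANY map `X̄ : R → S` (in the cell: the logarithm / derivation of the unipotent substitution,
restricted to `σ`-free elements) intertwined with `∂_σ` by `Ψ̄ (X̄ f) = ∂_σ (Ψ̄ f)` for `σ`-free `f ∈ R`.

* `derivative_C_mul_X_pow_eq_zero_of_dvd` : in characteristic `p`, `∂_σ (a σ^e) = 0` when `p ∣ e` (formal: `e·σ^{e−1} = 0`);
* `xbar_eq_zero_of_boundary_relation` (**T21 core**): if moreover `Ψ̄ (G₀) = G₀ − (c^p K)·σ^e` with `G₀, K, c ∈ R` and `p ∣ e`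
  (the cell: `e = 4p` at the (O2) point), then `X̄ G₀ = 0` — apply `Ψ̄`: `Ψ̄ (X̄ G₀) = ∂_σ (G₀ − c^p K σ^{e}) = 0 = Ψ̄ 0`, and `Ψ̄` is injective;
* `xbar_eq_zero_of_map_C_sub_C_eq` : the same with the boundary term any `B` with `∂_σ B = 0`.

What is NOT here: the construction of `X̄` from `Ψ̄` (truncated logarithm; see `Literature/RingTheory/Derivation/IterativeHasseSchmidt`) and
the identification of the boundary relation — those are engine 1's STEPs 1–3 of LEMMA LQ.

[ATW24] Abramovich–Temkin–Włodarczyk, Algebra & Number Theory 18 (2024), §5.1 (p. 1575).  CONTEXT ONLY; the packaging is ours.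
-/

namespace Literature.AlgebraicGeometry.Resolution.WeightedBlowup

open Polynomial

variable {R : Type*} [CommRing R] (p : ℕ) [CharP R p]

/-- In characteristic `p`, `∂_σ (a·σ^e) = 0` when `p ∣ e` (derived here). [cite: AbramovichTemkinWlodarczyk2024, §5.1 (p. 1575)] -/
theorem derivative_C_mul_X_pow_eq_zero_of_dvd (a : R) {e : ℕ} (he : p ∣ e) : derivative (C a * X ^ e) = 0 := by
  rw [derivative_C_mul_X_pow, (CharP.cast_eq_zero_iff R p e).mpr he, mul_zero, C_0, zero_mul]

/-- … in particular `∂_σ σ^e = 0` (derived here). [cite: AbramovichTemkinWlodarczyk2024, §5.1 (p. 1575)] -/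
theorem derivative_X_pow_eq_zero_of_dvd {e : ℕ} (he : p ∣ e) : derivative (X ^ e : R[X]) = 0 := by
  simpa using derivative_C_mul_X_pow_eq_zero_of_dvd p (1 : R) he

omit [CharP R p] in
/-- Abstract no-bands step (derived here): `Ψ̄` an injective ring endomorphism of `R[σ]`, `X̄ : R → R[σ]` with
`Ψ̄ (X̄ f) = ∂_σ (Ψ̄ f)` for `σ`-free `f`, and `Ψ̄ G₀ = G₀ − B` with `∂_σ B = 0` ⇒ `X̄ G₀ = 0`.
[cite: AbramovichTemkinWlodarczyk2024, §5.1 (p. 1575)] -/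
theorem xbar_eq_zero_of_map_C_sub_C_eq (Ψ : R[X] →+* R[X]) (hΨ : Function.Injective Ψ) (Xbar : R → R[X])
    (hder : ∀ f : R, Ψ (Xbar f) = derivative (Ψ (C f))) {G₀ : R} {B : R[X]} (hB : derivative B = 0)
    (hG : Ψ (C G₀) = C G₀ - B) : Xbar G₀ = 0 := by
  apply hΨ
  rw [map_zero, hder, hG, derivative_sub, derivative_C, hB, sub_zero]

/-- **T21 core (LEMMA LQ STEP 4_Q).**  `R` of characteristic `p`, `Ψ̄` an injective ring endomorphism of `R[σ]`, `X̄ : R → R[σ]` with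
`Ψ̄ (X̄ f) = ∂_σ (Ψ̄ f)` for `σ`-free `f`, and the boundary relation `Ψ̄ (G₀) = G₀ − (c^p·K)·σ^e` with `G₀, K, c` `σ`-free and `p ∣ e`
(`e = 4p` in the cell) ⇒ `X̄ G₀ = 0` (derived here). [cite: AbramovichTemkinWlodarczyk2024, §5.1 (p. 1575)] -/
theorem xbar_eq_zero_of_boundary_relation (Ψ : R[X] →+* R[X]) (hΨ : Function.Injective Ψ) (Xbar : R → R[X])
    (hder : ∀ f : R, Ψ (Xbar f) = derivative (Ψ (C f))) {G₀ K c : R} {e : ℕ} (he : p ∣ e)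
    (hG : Ψ (C G₀) = C G₀ - C (c ^ p * K) * X ^ e) : Xbar G₀ = 0 :=
  xbar_eq_zero_of_map_C_sub_C_eq Ψ hΨ Xbar hder (derivative_C_mul_X_pow_eq_zero_of_dvd p (c ^ p * K) he) hG

/-- The cell's instance `e = 4p` (derived here). [cite: AbramovichTemkinWlodarczyk2024, §5.1 (p. 1575)] -/
theorem xbar_eq_zero_of_boundary_relation_four_mul (Ψ : R[X] →+* R[X]) (hΨ : Function.Injective Ψ) (Xbar : R → R[X])
    (hder : ∀ f : R, Ψ (Xbar f) = derivative (Ψ (C f))) {G₀ K c : R}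
    (hG : Ψ (C G₀) = C G₀ - C (c ^ p * K) * X ^ (4 * p)) : Xbar G₀ = 0 :=
  xbar_eq_zero_of_boundary_relation p Ψ hΨ Xbar hder (Dvd.intro_left 4 rfl) hG

end Literature.AlgebraicGeometry.Resolution.WeightedBlowup
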